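import Literature.Geometry.Kaehler.TwoFormPowers
import Literature.NumberTheory.Transcendental.FormsAlgebraWedgeAssocProofs
import Literature.NumberTheory.Transcendental.FormsAlgebraWedgeCommProofs
import Literature.NumberTheory.Transcendental.FormsAlgebraWedgeProofs
import Mathlib.Analysis.Calculus.DifferentialForm.Basic
import HarnessLib

/-!
# The transgression formula `A^{q+1} - B^{q+1} = d(θ ∧ R_q(A, B))` for closed `2`-forms with `A - B = dθ`

Real `2`-covectors on a normed space commute under the wedge product
(`ContinuousAlternatingMap.wedge` of `Literature/NumberTheory/Transcendental/FormsAlgebra.lean`,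
with `WedgeAssoc_holds`, `WedgeComm_holds`), so they generate a commutative algebra in which the
school identity `A^{q+1} - B^{q+1} = (A - B)(A^q + A^{q-1}B + ⋯ + B^q)` holds. This file sets up:

* the wedge powers `A^r = A.twoPow r : V [⋀^Fin (2r)]→L[ℝ] ℝ` of
  `Literature/Geometry/Kaehler/TwoFormPowers.lean` (`ContinuousAlternatingMap.twoPow`; here
  `twoPow_zero'`, `twoPow_succ'` remove the definitional degree casts of its recursion);
* `twoFormGeom A B q : V [⋀^Fin (2q)]→L[ℝ] ℝ` — the "geometric sum" `R_q(A, B)` defined by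
  `R_0 = 1`, `R_{q+1} = A^{q+1} + B ∧ R_q` (`= Σ_{j ≤ q} A^j B^{q-j}`, no `ℕ`-subtraction);
* `twoPow_succ_sub_twoPow_succ` — **`A^{q+1} - B^{q+1} = (A - B) ∧ R_q(A, B)`** (up to the
  reindexing `Fin (2 + 2q) ≃ Fin (2(q+1))`);

and, for `2`-form FIELDS `x ↦ A x`, `x ↦ B x`:

* `contDiff_twoPow`, `contDiff_twoFormGeom` — smoothness;
* `extDeriv_twoPow_eq_zero`, `extDeriv_twoFormGeom_eq_zero` — **powers and geometric sums of
  CLOSED `2`-forms are closed** (Leibniz rule `extDerivWithin_wedge`; the manifold-level statement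
  for powers is `twoFormPow_mem_closedSmoothForms` of `TwoFormPowers.lean`);
* `extDeriv_wedge_twoFormGeom` — **if `dθ = A - B` for a `1`-form field `θ` then
  `d(θ ∧ R_q(A, B)) = A^{q+1} - B^{q+1}`**: the transgression formula behind
  "`(dd^c u)^p - (dd^c v)^p = d(d^c(u - v) ∧ Σ (dd^c u)^k ∧ (dd^c v)^{p-1-k})`", the integration by
  parts of Monge–Ampère operators [Demailly, *Complex analytic and differential geometry*,
  Ch. III §3; Chirka1989, §15.1 (proof of Prop. 1)].

Everything is definitions with bodies and theorems proved from the tree's wedge calculus.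

## References

* J.-P. Demailly, *Complex analytic and differential geometry*, Ch. III, §§1–3, 5, 7.
* F. W. Warner, *Foundations of Differentiable Manifolds and Lie Groups*, GTM 94, 2.6–2.20
  [WarnerGTM94].
* E. M. Chirka, *Complex Analytic Sets*, Kluwer 1989, §15.1 [Chirka1989].
-/

open scoped Topology
open Set Filter

noncomputable section

namespace Literature.Geometry.Kaehler

namespace TwoForm

variable {V : Type*} [NormedAddCommGroup V] [NormedSpace ℝ V]

/-! ### Reindexing along equal degrees -/

/-- Reindexing a covector along `finCongr h`, `h : k = k'`, as used for degree bookkeeping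
(`(cast h α) v = α (v ∘ Fin.cast h)`). [folklore] -/
abbrev cast {k k' : ℕ} (h : k = k') (α : V [⋀^Fin k]→L[ℝ] ℝ) : V [⋀^Fin k']→L[ℝ] ℝ :=
  α.domDomCongr (finCongr h)

/-- `cast rfl = id`. [folklore] -/
@[simp] theorem cast_rfl {k : ℕ} (α : V [⋀^Fin k]→L[ℝ] ℝ) : cast rfl α = α := by
  ext v; rfl

/-- Casts compose. [folklore] -/
theorem cast_cast {k k' k'' : ℕ} (h : k = k') (h' : k' = k'') (α : V [⋀^Fin k]→L[ℝ] ℝ) :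
    cast h' (cast h α) = cast (h.trans h') α := by
  subst h; subst h'; simp

/-- Any two casts between the same degrees agree (proof irrelevance). [folklore] -/
theorem cast_eq_cast {k k' : ℕ} (h h' : k = k') (α : V [⋀^Fin k]→L[ℝ] ℝ) : cast h α = cast h' α :=
  rfl

/-- Casts are additive. [folklore] -/
theorem cast_add {k k' : ℕ} (h : k = k') (α β : V [⋀^Fin k]→L[ℝ] ℝ) :
    cast h (α + β) = cast h α + cast h β := rfl

/-- Casts commute with subtraction. [folklore] -/
theorem cast_sub {k k' : ℕ} (h : k = k') (α β : V [⋀^Fin k]→L[ℝ] ℝ) :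
    cast h (α - β) = cast h α - cast h β := by
  subst h; simp

/-- Casts commute with scalars. [folklore] -/
theorem cast_smul {k k' : ℕ} (h : k = k') (c : ℝ) (α : V [⋀^Fin k]→L[ℝ] ℝ) :
    cast h (c • α) = c • cast h α := rfl

/-- The cast of `0` is `0`. [folklore] -/
theorem cast_zero {k k' : ℕ} (h : k = k') : cast h (0 : V [⋀^Fin k]→L[ℝ] ℝ) = 0 := rfl

/-- Casting is injective. [folklore] -/
theorem cast_injective {k k' : ℕ} (h : k = k') : Function.Injective (cast (V := V) h) := by
  subst h; intro α β hαβ; simpa using hαβ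

/-- A cast can be moved to the other side. [folklore] -/
theorem cast_eq_iff_eq_cast_symm {k k' : ℕ} (h : k = k') (α : V [⋀^Fin k]→L[ℝ] ℝ)
    (β : V [⋀^Fin k']→L[ℝ] ℝ) : cast h α = β ↔ α = cast h.symm β := by
  subst h; simp

/-- Casting the left factor of a wedge product. [folklore] -/
theorem cast_wedge_left {k k' l : ℕ} (h : k = k') (α : V [⋀^Fin k]→L[ℝ] ℝ)
    (β : V [⋀^Fin l]→L[ℝ] ℝ) :
    (cast h α).wedge β = cast (by rw [h]) (α.wedge β) := by
  subst h; simp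

/-- Casting the right factor of a wedge product. [folklore] -/
theorem cast_wedge_right {k l l' : ℕ} (h : l = l') (α : V [⋀^Fin k]→L[ℝ] ℝ)
    (β : V [⋀^Fin l]→L[ℝ] ℝ) :
    α.wedge (cast h β) = cast (by rw [h]) (α.wedge β) := by
  subst h; simp

/-! ### The commutative algebra of even forms: associativity and commutativity with casts -/

/-- Associativity of `∧` with the degree cast (the tree's `WedgeAssoc_holds`). [folklore] -/
theorem wedge_assoc {k l m : ℕ} (α : V [⋀^Fin k]→L[ℝ] ℝ) (β : V [⋀^Fin l]→L[ℝ] ℝ)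
    (γ : V [⋀^Fin m]→L[ℝ] ℝ) :
    (α.wedge β).wedge γ = cast (Nat.add_assoc k l m).symm (α.wedge (β.wedge γ)) :=
  ContinuousAlternatingMap.WedgeAssoc_holds ℝ V ℝ α β γ

/-- A `2`-form commutes with every form: `β ∧ A = A ∧ β` (graded commutativity with even degree,
the tree's `WedgeComm_holds`). [folklore] -/
theorem wedge_comm_two {l : ℕ} (A : V [⋀^Fin 2]→L[ℝ] ℝ) (β : V [⋀^Fin l]→L[ℝ] ℝ) :
    β.wedge A = cast (Nat.add_comm 2 l) (A.wedge β) := by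
  have h := ContinuousAlternatingMap.WedgeComm_holds ℝ V ℝ A β
  rw [h]
  have h1 : ((-1 : ℝ) ^ (2 * l)) = 1 := by
    rw [pow_mul]; simp
  rw [h1, one_smul]

/-! ### Wedge powers of a `2`-form (from `TwoFormPowers.lean`), without degree casts -/

/-- `A^0 = 1` (the recursion of `ContinuousAlternatingMap.twoPow` reindexes along `0 = 2 * 0`,
which holds definitionally). [folklore] -/
theorem twoPow_zero' (A : V [⋀^Fin 2]→L[ℝ] ℝ) :
    A.twoPow 0 = ContinuousAlternatingMap.constOfIsEmpty ℝ V (Fin 0) (1 : ℝ) := by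
  rw [ContinuousAlternatingMap.twoPow_zero]
  exact cast_rfl _

/-- `A^{r+1} = A^r ∧ A` (the recursion of `ContinuousAlternatingMap.twoPow` reindexes along
`2 * r + 2 = 2 * (r + 1)`, which holds definitionally). [folklore] -/
theorem twoPow_succ' (A : V [⋀^Fin 2]→L[ℝ] ℝ) (r : ℕ) :
    A.twoPow (r + 1) = (A.twoPow r).wedge A := by
  rw [ContinuousAlternatingMap.twoPow_succ]
  exact cast_rfl _

/-- `A^1 = A` (up to the cast `2 * 1 = 0 + 2`). [folklore] -/
theorem twoPow_one' (A : V [⋀^Fin 2]→L[ℝ] ℝ) :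
    A.twoPow 1 = cast (Nat.zero_add 2).symm A := by
  rw [twoPow_succ', twoPow_zero', ContinuousAlternatingMap.constOfIsEmpty_one_wedge]

/-! ### The geometric sum `R_q(A, B) = Σ_{j ≤ q} A^j ∧ B^{q-j}` -/

/-- **The geometric sum `R_q(A, B)`**, defined without subtraction by `R_0 = 1`,
`R_{q+1} = A^{q+1} + B ∧ R_q` (so that `R_q = A^q + A^{q-1} ∧ B + ⋯ + B^q` in the commutative
algebra of even forms). [folklore] -/
def twoFormGeom (A B : V [⋀^Fin 2]→L[ℝ] ℝ) : (q : ℕ) → V [⋀^Fin (2 * q)]→L[ℝ] ℝ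
  | 0 => ContinuousAlternatingMap.constOfIsEmpty ℝ V (Fin 0) (1 : ℝ)
  | q + 1 => A.twoPow (q + 1) + cast (Nat.add_comm 2 (2 * q)) (B.wedge (twoFormGeom A B q))

/-- `R_0 = 1`. [folklore] -/
theorem twoFormGeom_zero (A B : V [⋀^Fin 2]→L[ℝ] ℝ) :
    twoFormGeom A B 0 = ContinuousAlternatingMap.constOfIsEmpty ℝ V (Fin 0) (1 : ℝ) := rfl

/-- `R_{q+1} = A^{q+1} + B ∧ R_q`. [folklore] -/
theorem twoFormGeom_succ (A B : V [⋀^Fin 2]→L[ℝ] ℝ) (q : ℕ) :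
    twoFormGeom A B (q + 1) =
      A.twoPow (q + 1) + cast (Nat.add_comm 2 (2 * q)) (B.wedge (twoFormGeom A B q)) := rfl

/-! ### `A^{q+1} - B^{q+1} = (A - B) ∧ R_q(A, B)` -/

/-- Two `2`-forms commute on the nose: `C ∧ B = B ∧ C`. [folklore] -/
theorem wedge_comm_two_two (B C : V [⋀^Fin 2]→L[ℝ] ℝ) : C.wedge B = B.wedge C := by
  rw [wedge_comm_two B C]
  exact cast_rfl _

/-- `1` (the constant `0`-form) is a right unit: `α ∧ 1 = α` up to the cast `k = k + 0`.
[folklore] -/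
theorem wedge_one_right {k : ℕ} (α : V [⋀^Fin k]→L[ℝ] ℝ) :
    α.wedge (ContinuousAlternatingMap.constOfIsEmpty ℝ V (Fin 0) (1 : ℝ)) =
      cast (Nat.add_zero k).symm α := by
  have h := ContinuousAlternatingMap.WedgeComm_holds ℝ V ℝ α
    (ContinuousAlternatingMap.constOfIsEmpty ℝ V (Fin 0) (1 : ℝ))
  -- `h : 1 ∧ α = (-1)^(k*0) • cast (α ∧ 1)`
  rw [mul_zero, pow_zero, one_smul, ContinuousAlternatingMap.constOfIsEmpty_one_wedge] at h
  -- `h : cast _ α = cast _ (α ∧ 1)`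
  have h' := congrArg (cast (Nat.add_comm k 0).symm) h
  rw [cast_cast, cast_cast] at h'
  rw [← cast_rfl (α.wedge _)]
  rw [cast_eq_cast rfl ((Nat.add_comm k 0).trans (Nat.add_comm k 0).symm)]
  rw [← h']

/-- `(α - β) ∧ γ = α ∧ γ - β ∧ γ`. [folklore] -/
theorem sub_wedge {k l : ℕ} (α β : V [⋀^Fin k]→L[ℝ] ℝ) (γ : V [⋀^Fin l]→L[ℝ] ℝ) :
    (α - β).wedge γ = α.wedge γ - β.wedge γ := by
  rw [sub_eq_add_neg, ContinuousAlternatingMap.wedge_add_left, sub_eq_add_neg, ← neg_one_smul ℝ β,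
    ContinuousAlternatingMap.wedge_smul_left, neg_one_smul]

/-- `α ∧ (β - γ) = α ∧ β - α ∧ γ`. [folklore] -/
theorem wedge_sub {k l : ℕ} (α : V [⋀^Fin k]→L[ℝ] ℝ) (β γ : V [⋀^Fin l]→L[ℝ] ℝ) :
    α.wedge (β - γ) = α.wedge β - α.wedge γ := by
  rw [sub_eq_add_neg, ContinuousAlternatingMap.wedge_add_right, sub_eq_add_neg,
    ← neg_one_smul ℝ γ, ContinuousAlternatingMap.wedge_smul_right, neg_one_smul]

/-- `B ∧ (C ∧ β) = C ∧ (B ∧ β)` for `2`-forms `B, C`. [folklore] -/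
theorem wedge_wedge_comm_two {l : ℕ} (B C : V [⋀^Fin 2]→L[ℝ] ℝ) (β : V [⋀^Fin l]→L[ℝ] ℝ) :
    B.wedge (C.wedge β) = C.wedge (B.wedge β) := by
  have h1 := wedge_assoc B C β
  have h2 := wedge_assoc C B β
  rw [wedge_comm_two_two B C] at h2
  exact cast_injective _ (h1.symm.trans h2)

/-- `A ∧ A^r = A^{r+1}` (up to the cast `2 + 2r = 2(r+1)`). [folklore] -/
theorem wedge_twoPow (A : V [⋀^Fin 2]→L[ℝ] ℝ) (r : ℕ) :
    A.wedge (A.twoPow r) = cast (Nat.add_comm (2 * r) 2) (A.twoPow (r + 1)) := by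
  rw [twoPow_succ', wedge_comm_two A (A.twoPow r), cast_cast]
  exact (cast_rfl _).symm

/-- **The school identity in the even algebra**: `A^{q+1} - B^{q+1} = (A - B) ∧ R_q(A, B)`, up to
the cast `2 + 2q = 2(q+1)`. Induction: `A^{q+2} - B^{q+2} = (A - B) ∧ A^{q+1} + B ∧ (A^{q+1} -
B^{q+1})` and `B ∧ ((A - B) ∧ R_q) = (A - B) ∧ (B ∧ R_q)`. [folklore] -/
theorem twoPow_succ_sub_twoPow_succ (A B : V [⋀^Fin 2]→L[ℝ] ℝ) (q : ℕ) :
    A.twoPow (q + 1) - B.twoPow (q + 1) =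
      cast (Nat.add_comm 2 (2 * q)) ((A - B).wedge (twoFormGeom A B q)) := by
  induction q with
  | zero =>
    rw [twoFormGeom_zero, wedge_one_right, cast_cast, twoPow_one', twoPow_one', ← cast_sub]
  | succ q ih =>
    -- `(A - B) ∧ R_{q+1} = (A - B) ∧ A^{q+1} + (A - B) ∧ (B ∧ R_q)`
    rw [twoFormGeom_succ, ContinuousAlternatingMap.wedge_add_right, cast_wedge_right, cast_add,
      cast_cast, wedge_wedge_comm_two (A - B) B]
    -- use the induction hypothesis inside `B ∧ ((A - B) ∧ R_q)`
    have ih' : (A - B).wedge (twoFormGeom A B q) =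
        cast (Nat.add_comm 2 (2 * q)).symm (A.twoPow (q + 1) - B.twoPow (q + 1)) := by
      rw [(cast_eq_iff_eq_cast_symm _ _ _).1 ih.symm]
    rw [ih', cast_wedge_right, cast_cast, wedge_sub, sub_wedge, wedge_twoPow, wedge_twoPow]
    -- everything is now a combination of casts of `A^{q+2}`, `B^{q+2}`, `B ∧ A^{q+1}`
    rw [cast_sub, cast_sub, cast_cast, cast_cast]
    have hA : cast ((Nat.add_comm (2 * (q + 1)) 2).trans (Nat.add_comm 2 (2 * (q + 1))))
        (A.twoPow (q + 1 + 1)) = A.twoPow (q + 1 + 1) := cast_rfl _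
    have hB : cast ((Nat.add_comm (2 * (q + 1)) 2).trans (Nat.add_comm 2 (2 * (q + 1))))
        (B.twoPow (q + 1 + 1)) = B.twoPow (q + 1 + 1) := cast_rfl _
    rw [cast_eq_cast _ ((Nat.add_comm (2 * (q + 1)) 2).trans (Nat.add_comm 2 (2 * (q + 1))))
      (A.twoPow (q + 1 + 1)), hA,
      cast_eq_cast _ ((Nat.add_comm (2 * (q + 1)) 2).trans (Nat.add_comm 2 (2 * (q + 1))))
      (B.twoPow (q + 1 + 1)), hB]
    abel

/-! ### Fields of `2`-forms: smoothness -/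

section Fields

open Literature.NumberTheory.Transcendental

variable {A B : V → V [⋀^Fin 2]→L[ℝ] ℝ} {n : WithTop ℕ∞}

/-- The wedge of `C^n` fields of forms is `C^n`. [folklore] -/
theorem contDiff_wedge {k l : ℕ} {f : V → V [⋀^Fin k]→L[ℝ] ℝ} {g : V → V [⋀^Fin l]→L[ℝ] ℝ}
    (hf : ContDiff ℝ n f) (hg : ContDiff ℝ n g) : ContDiff ℝ n fun x => (f x).wedge (g x) := by
  rw [contDiff_iff_contDiffAt] at hf hg ⊢
  intro x
  have := ContDiffWithinAt.wedge (𝕜 := ℝ) (A := ℝ) (s := Set.univ) (hf x).contDiffWithinAt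
    (hg x).contDiffWithinAt
  exact this.contDiffAt Filter.univ_mem

/-- Casting the degree preserves smoothness. [folklore] -/
theorem contDiff_cast {k k' : ℕ} (h : k = k') {f : V → V [⋀^Fin k]→L[ℝ] ℝ} (hf : ContDiff ℝ n f) :
    ContDiff ℝ n fun x => cast h (f x) := by
  subst h; simpa using hf

/-- **Powers of a `C^n` field of `2`-forms are `C^n`.** [folklore] -/
theorem contDiff_twoPow (hA : ContDiff ℝ n A) (r : ℕ) :
    ContDiff ℝ n fun x => (A x).twoPow r := by
  induction r with
  | zero => exact contDiff_const
  | succ r ih => exact contDiff_wedge ih hA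

/-- **Geometric sums of `C^n` fields of `2`-forms are `C^n`.** [folklore] -/
theorem contDiff_twoFormGeom (hA : ContDiff ℝ n A) (hB : ContDiff ℝ n B) (q : ℕ) :
    ContDiff ℝ n fun x => twoFormGeom (A x) (B x) q := by
  induction q with
  | zero => exact contDiff_const
  | succ q ih =>
    exact (contDiff_twoPow hA (q + 1)).add (contDiff_cast _ (contDiff_wedge hB ih))

/-! ### Fields of `2`-forms: closedness of powers and geometric sums -/

/-- The exterior derivative commutes with degree casts. [folklore] -/
theorem extDeriv_cast {k k' : ℕ} (h : k = k') (f : V → V [⋀^Fin k]→L[ℝ] ℝ) (x : V) :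
    extDeriv (fun y => cast h (f y)) x = cast (by rw [h]) (extDeriv f x) := by
  subst h; simp

/-- **Leibniz rule** for fields on a normed space (the tree's `extDerivWithin_wedge` on `univ`).
[cite: WarnerGTM94, Thm. 2.20] -/
theorem extDeriv_wedge {k l : ℕ} {f : V → V [⋀^Fin k]→L[ℝ] ℝ} {g : V → V [⋀^Fin l]→L[ℝ] ℝ} {x : V}
    (hf : DifferentiableAt ℝ f x) (hg : DifferentiableAt ℝ g x) :
    extDeriv (fun y => (f y).wedge (g y)) x =
      cast (Nat.add_right_comm k 1 l) ((extDeriv f x).wedge (g x)) +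
        ((-1 : ℝ) ^ k • (f x).wedge (extDeriv g x) : V [⋀^Fin (k + l + 1)]→L[ℝ] ℝ) := by
  simp only [← extDerivWithin_univ]
  exact extDerivWithin_wedge hf.differentiableWithinAt hg.differentiableWithinAt uniqueDiffWithinAt_univ

/-- **Powers of a closed `C¹` field of `2`-forms are closed**: `d(A^r) = 0` if `dA = 0`.
[folklore] -/
theorem extDeriv_twoPow_eq_zero (hA : ContDiff ℝ 1 A) (hdA : ∀ x, extDeriv A x = 0) (r : ℕ) (x : V) :
    extDeriv (fun y => (A y).twoPow r) x = 0 := by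
  induction r generalizing x with
  | zero =>
    simp only [twoPow_zero']
    ext v
    rw [extDeriv_apply (differentiableAt_const _)]
    simp
  | succ r ih =>
    simp only [twoPow_succ']
    rw [extDeriv_wedge ((contDiff_twoPow hA r).differentiable one_ne_zero x)
      (hA.differentiable one_ne_zero x), ih x, hdA x, ContinuousAlternatingMap.zero_wedge,
      ContinuousAlternatingMap.wedge_zero, cast_zero, smul_zero, add_zero]

/-- **Geometric sums of closed `C¹` fields of `2`-forms are closed**: `d R_q(A, B) = 0` if
`dA = dB = 0`. [folklore] -/
theorem extDeriv_twoFormGeom_eq_zero (hA : ContDiff ℝ 1 A) (hB : ContDiff ℝ 1 B)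
    (hdA : ∀ x, extDeriv A x = 0) (hdB : ∀ x, extDeriv B x = 0) (q : ℕ) (x : V) :
    extDeriv (fun y => twoFormGeom (A y) (B y) q) x = 0 := by
  induction q generalizing x with
  | zero =>
    simp only [twoFormGeom_zero]
    ext v
    rw [extDeriv_apply (differentiableAt_const _)]
    simp
  | succ q ih =>
    simp only [twoFormGeom_succ]
    rw [extDeriv_fun_add ((contDiff_twoPow hA (q + 1)).differentiable one_ne_zero x)
      ((contDiff_cast _ (contDiff_wedge hB (contDiff_twoFormGeom hA hB q))).differentiable
        one_ne_zero x),
      extDeriv_twoPow_eq_zero hA hdA, zero_add, extDeriv_cast,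
      extDeriv_wedge (hB.differentiable one_ne_zero x)
        ((contDiff_twoFormGeom hA hB q).differentiable one_ne_zero x),
      ih x, hdB x, ContinuousAlternatingMap.zero_wedge, ContinuousAlternatingMap.wedge_zero,
      cast_zero, smul_zero, add_zero, cast_zero]

/-! ### The transgression formula `d(θ ∧ R_q(A, B)) = A^{q+1} - B^{q+1}` when `dθ = A - B` -/

/-- **Transgression formula.** Let `A`, `B` be closed `C¹` fields of `2`-forms and `θ` a `C¹`
field of `1`-forms with `dθ = A - B`. Then `d(θ ∧ R_q(A, B)) = A^{q+1} - B^{q+1}` (up to the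
degree cast `(1 + 2q) + 1 = 2(q+1)`). With `A = dd^c u`, `B = dd^c v`, `θ = d^c(u - v)` this is
`(dd^c u)^{q+1} - (dd^c v)^{q+1} = d(d^c(u - v) ∧ Σ_j (dd^c u)^j ∧ (dd^c v)^{q-j})`, the identity
behind the integration by parts of Monge–Ampère operators against closed currents.
[Demailly, Ch. III §3; Chirka1989, §15.1] [folklore] -/
theorem extDeriv_wedge_twoFormGeom {θ : V → V [⋀^Fin 1]→L[ℝ] ℝ} (hθ : ContDiff ℝ 1 θ)
    (hA : ContDiff ℝ 1 A) (hB : ContDiff ℝ 1 B) (hdA : ∀ x, extDeriv A x = 0)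
    (hdB : ∀ x, extDeriv B x = 0) (hdθ : ∀ x, extDeriv θ x = A x - B x) (q : ℕ) (x : V) :
    extDeriv (fun y => (θ y).wedge (twoFormGeom (A y) (B y) q)) x =
      cast (by omega) ((A x).twoPow (q + 1) - (B x).twoPow (q + 1)) := by
  rw [extDeriv_wedge (hθ.differentiable one_ne_zero x)
      ((contDiff_twoFormGeom hA hB q).differentiable one_ne_zero x),
    extDeriv_twoFormGeom_eq_zero hA hB hdA hdB q x, ContinuousAlternatingMap.wedge_zero, smul_zero,
    add_zero, hdθ x, twoPow_succ_sub_twoPow_succ, cast_cast]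

end Fields

end TwoForm

end Literature.Geometry.Kaehler

end
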